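import Summits.BirchSwinnertonDyer.BirchSwinnertonDyer.Theorems.ByReductionTypeAtTwoRankOneAtTwoOneDoorLawBottomDefs
import Summits.BirchSwinnertonDyer.Rank1Residual.F1Sign2.KummerEntanglementAtTwo
import Literature.NumberTheory.EllipticCurves.Tamagawa
import Literature.NumberTheory.EllipticCurves.HeegnerPointsKolyvaginPairing
import Literature.NumberTheory.EllipticCurves.SelmerUnramified
import Literature.NumberTheory.EllipticCurves.SelmerTorsionInclusion
import Literature.NumberTheory.EllipticCurves.ArchimedeanLocalConditionTorsion
import HarnessLib

/-!
# Cell `bsd-f1-sign2`, ES-21: WHERE THE ČEBOTAREV BLIND SPOT IS SELMER — per-place local laws for the level-4 class at 2 (-es g12, MEMO-es §21 + §21.8–21.9; crux idea `blind-spot-local-laws-at-two`)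

TYPER FILING (cell `bsd-f1-sign2`, seat `-ty` g11; -es g12 filing ask D-es-63 (16:21:42Z) «port `Sketch21.lean` → `F1Sign2/BlindSpotLocalLawsAtTwo.lean`
(`@[conjecture]` on ES-21b₁/b₂ only)», scope += §B (16:28:01Z; Sketch21 v2 a2cb73a74d2b504f = `HOME/data-es/g12/Sketch21.lean`, rc 0 · 0 err · 0 warn · 0 sorry;
`Probe21.lean`/`Probe21B.lean` BC7 9/9 CLEAN); REF1 D-es-65 ANSWERED §127 — gate CLEARED «file as typed»): the sketch body VERBATIM — same namespace
`…Rank1Residual.F1Sign2.BlindSpotLocalLawsAtTwo`, same imports — with the typer's tags: `@[conjecture]` on ES-21b₁ `BlindSpotNotKummerAtTwoOrdinary` and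
ES-21b₂ `BlindSpotNotKummerAtTwoMultiplicativeOddVal` ONLY (-es's instruction; conjecture-grade census laws at v = 2); ES-21a
`BlindSpotRamifiedAtOddMultiplicativeAtTwo` (Λ_odd-mult, THEOREM-grade, paper proof MEMO-es §21.2 (i)–(iv)), support `OddValOfOddTamagawaMultiplicative`
(Tate's c_p table), ES-21a′ `SelmerRestrictionInjectiveOfOddMultiplicativeAtTwo`, ES-21c `BlindSpotSelmerOnlyOnThinFamilyAtTwo` and the §B leaves L1
`LevelFourClassRamifiedAtOddMultiplicative`, L2 `KummerUnramifiedAtOddMultiplicativeOddVal`, L3 `BlindSpotFromLevelFour` are PLAIN `def … : Prop` rows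
(binder-names; nothing asserted); carriers `primePlace`, `DiesOnDivisionField`; glue `selmerRestrictionInjective_of_blindSpotRamified`,
`selmer_eq_zero_of_dies_slice`, `blindSpotSelmerOnlyOnThinFamily_of_laws`, L4 `torsionH1OfDvd_mem_selmerLocalKer_iff`, `two_dvd_two_pow`,
`blindSpotRamifiedAtOddMultiplicative_of : L1 → L2 → L3 → ES-21a` PROVED (kernel).  Typer edits = this header, the two `@[conjecture]` tags, the
REF1/REF2 sentences, and the sketch's `set_option linter.dupNamespace false` dropped (unneeded).  No instance, no notation.  Nothing here proves BSD.
Census = BC5 WITNESS: F21 kit **j312155** (tag `bsd-frontier-data`, 8 cores; 2 814 curves = DES13 510 + ENGINE-S 1 713 (+1 576 door twins) + W52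
habitat 591; 0 ERROR / 0 TIMEOUT; `HOME/data-es/g12/es21/CENSUS21-j312155.txt` ba5ce9ef40639b75): Λ_odd-mult 8 529/8 529 instances with exactly the
ramified/unramified mechanism; at 2: ordinary ⇒ x_2 = 0 734/734, multiplicative v₂Δ odd ⇒ x_2 = 0 1 384/1 384, supersingular ⇒ x_2 = 1 788/788;
transposition door prime x_q(E^d) = [a_q(E) ≡ 0 mod 4] 1 117/1 117; x_v(E^d) = x_v(E) at v ∣ 2N 5 094/5 094; on the 23715 slice restriction
injective for E and E^d on 1 357/1 368 Δ < 0 curves, b = 1 only on the thin family 𝔉 (13/2 811: 190512l1, 3888c1, 15552j1, 363609v1 + 9 W52);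
0/1 576 door twins with b(E^d) = 1; §21.9: étale shadow η = χ_{−Δ} on 451/451 ordinary curves (x₂ = 0 proved on Δ ≡ 1 (4), 172/451; Δ ≡ 3 (4)
279/279 the conjectural half of ES-21b₁).
REF1-AUDIT §127 (refuter-bsd-f1-sign2-ref1 g11, 2026-08-28T17:24:56Z; `REF1-AUDIT-v1.md` l.2493; evidence `HOME/REF1-data/b127/` — Sketch21_copy
a2cb73a74d2b504f rc 0, Probe127.lean 9d5da7fadf5bfcb4 + probe127.out b9c1290ca0fabdd8 (9 axiom blocks standard), `h1gl2z4.py` 63a20ddf85a4da2f / .out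
0d6a3d2a92b0b039; D-es-65 ANSWERED; gate D-es-63 «file as typed; L1–L3 as plain defs is -ty's call»): «ES-21a `BlindSpotRamifiedAtOddMultiplicativeAtTwo`
(Λ_odd-mult) CERTIFIED THEOREM-grade: the paper proof MEMO-es §21.2 (i)–(iv) is complete and correct, and its group-cohomological core (i)–(ii) is
REPLAYED by exhaustive 𝔽₂-linear algebra (dim Z¹(GL₂(ℤ/4), E[2]) = 3, dim B¹ = 2, H¹ = ℤ/2 with ONE non-zero class ξ; ξ|_{1+2M₂(ℤ/4)} = pr_V for every
cocycle in the class; M₂(𝔽₂) = 𝔫 ⊕ V, Hom_{S₃}(𝔫,V) = 0, H¹(S₃,E[2]) = 0; g = (1 1;0 1): ξ(g²) = pr_V(n₁₂) = t₂ ≠ 0 and [ξ|⟨g⟩] ≠ 0 — ramified also when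
the inertia image is only ⟨g²⟩, the v_p(Δ) ≡ 2 (4) row); (iii) K_p ⊂ H¹_ur is AEC C.14-standard (split: quotient by the odd-valuation q generated by the
non-square unit; non-split: Φ(𝔽_p) = (ℤ/v)[2] = 0, E = E₀, √unit ∈ ℚ_p^{ur}); twist clause covered (unramified twist = other Tate model, same v(Δ));
§B decomposition L1/L2/L3 sound, L4 + 6 glue theorems closed on {propext, Classical.choice, Quot.sound} (9/9); ES-21a′ THEOREM-grade given ES-21a
(support `OddValOfOddTamagawaMultiplicative` TRUE: Tate's table); ES-21b₁/b₂ SURVIVE conjecture-grade (734/734, 1 384/1 384; no cheap kill; rider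
r127-1: on Δ ≡ 7 (8) (122/451) −Δ is a 2-adic square so §21.9's étale shadow χ_{−Δ} vanishes — the second mechanism must produce loc₂ξ_E ∉ K₂ from
the connected part alone there); ES-21c assembled ✓ with two DECORATION binders (`¬ W.HasCM`, `Odd W.torsionOrder` never used — e1/e1′) and ES-21a's
∀(j,k) prefix reducible to (1,2) given L3 (e2/e2′: prove L1 ∧ L2 at level (1,2), import L3) — prover notes, not statement changes; kill attempts
k1–k6 all fail (tree `IsOrdinaryAt` = GOOD ordinary, so the multiplicative v₂(Δ) ≡ 2 (4) rows with x₂ = 1 do NOT refute b₁); O-REF1-127a: confirm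
F21's «onto» filter is 2-ADIC (ρ̄₈), cf. §126's 6/611 leak.  KILLED: none.»  Typer uptake: ES-21a/a′/c, support, L1–L3 filed as PLAIN `def`s
(theorem-grade statements / leaves; users' `(h : …)` binders), `@[conjecture]` on ES-21b₁/b₂ exactly as -es asked.
REF2-PLACEMENT v35-add1 §A2 + §A2-PS (refuter-bsd-f1-sign2-ref2 g35, 2026-08-28T16:29:36Z / 16:30:45Z; `HOME/REF2-PLACEMENT-v35-add1.md` 2b77f1ac648374dd;
D-es-65 placement half ANSWERED), REF2_TXT_ES21: «REF2 v35-add1 §A2: levers KNOWN (Lawson–Wuthrich 2016 level-4 class; Tate-curve inertia; odd-c_p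
Kummer image unramified); per-place Selmer-membership laws of the level-4 class and the McCallum-verbatim injectivity at p = 2 off the thin family NOT
IN PRINT — print excludes these places (Lawson–Wuthrich 2016 §8: Σ ⊇ {2, bad}; Çiperiani–Stix II: method cannot handle p = 2; Creutz 2013: one
example); NEW-COMBINATION-small; beyond-print theorem: no for the local laws, yes-small for the injectivity consequence if kernel-proved (as ES-19a, REF2
v32 §4). BSD is not proved by this.»  Per leaf (§A2-PS): L1 statement not in print, proof = S₃-module + Tate-period Kummer-character bookkeeping on
E[4] ⇒ VARIANT-small support lemma; L2 KNOWN-type (Tate curve; printed criterion «image of E(K_v)/p unramified at v ∤ p ⟺ p ∤ #Φ_v(k̄_v)», and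
#Φ(k̄) = v_p(Δ) for multiplicative reduction of EITHER type over K_v^ur, so the binder «v_p(Δ) odd» is exactly right and «c_p odd» alone would
NOT be; Schaefer–Stoll 2004 §3-type statement); L3 = ES-19b KNOWN-type (tree `F1Sign2/RealSignatureAtTwo.lean` p646969); L4 bookkeeping.
[cite: LawsonWuthrich2016, Thm. 2 (p > 3), §8] [cite: CiperianiStix2013II, p. 2] [cite: Creutz2013, Thm. 1] [cite: McCallumLMS1991, §3 Prop. 3.1, Cor. 3.2]
[cite: GrossLMS1991, Prop. 9.1] [cite: SilvermanAEC2009, C.14, C.15]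
PARTITION: none moved (numbers in MEMO-es §21.4 (d)); beyond-print theorem: no (ES-21a/a′ are theorem-grade STATEMENTS not in print; the file carries
defs + kernel glue only).  BSD is not proved; 23715 not closed.
bears_on: 23715 (`ByReductionTypeAtTwo.RankOneAtTwoBigImageOddLocal`: the Δ < 0 all-layers U / `stub_doorUpperOffBottom` may assume McCallum Prop.
3.1/Cor. 3.2 VERBATIM off 𝔉 — D-es-61 to the lead; GK2 items 28029/28030 «bit-loss allowance»); asks D-es-63 (-ty, this file), D-es-64 (gk2-p5/fkl-p2
DOWN law at q₀), D-es-65 (REF1/REF2).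

## The sketch's own summary (verbatim)

# MEMO-es §21 (cell `bsd-f1-sign2`, -es g12) — WHERE THE ČEBOTAREV BLIND SPOT IS SELMER: per-place local laws for the level-`4` class

Sketch (statement file + kernel glue; nothing here proves BSD).  Setting of crux
`ByReductionTypeAtTwo.RankOneAtTwoBigImageOddLocal` (stmt-23715): `ρ_{E,2^∞}` onto, odd torsion, odd Tamagawa, analytic rank `1`.

THE OBJECT (MEMO-es §13, gk2 §51 / p639364).  `ξ_E ∈ H¹(ℚ, E[2])` = the unique non-zero class dying on `Γ_{ℚ(E[4])}` (image onto
`GL₂(ℤ/4)`); explicitly the class of `α_E = -Δ_E · h'(θ)` in `ker(N : L*/L*² → ℚ*/ℚ*²)`, `L = ℚ(θ) = ℚ[u]/(h)` the cubic `2`-division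
algebra.  McCallum's restriction `Sel_{2^j}(E/ℚ) → Hom(Γ_{ℚ(E[2^k])}, E[2^j])` (1991, §3 (2)) has kernel `Sel_{2^j}(E) ∩ {0, ι_*ξ_E}`
(MEMO-es §19, `InflationLineAtTwoPow`), and `ι_*ξ_E ∈ Sel_{2^j}(E) ⟺ ξ_E ∈ Sel₂(E)` (same image in `H¹(ℚ_v, E)`).  So the blind spot of
the `p = 2` Kolyvagin–McCallum induction is the single bit `b(E) := [ξ_E ∈ Sel₂(E/ℚ)] = [Δ_E < 0] · x_2(E) · ∏_{v ∣ Δ odd} x_v(E)`,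
`x_v(E) := [loc_v ξ_E ∈ δ_v(E(ℚ_v)/2)]` (places `∤ 2Δ∞` impose nothing on the unramified class `ξ_E`; `∞`: MEMO-es §19 RIS⁺).

THE LAWS (this file; census = kit job of `es21/` over DES13 ∪ ENGINE-S(+1576 door twins) ∪ W52-habitat, 2814 curves):
* ES-21a (Λ_odd-mult, THEOREM-grade): `v` odd, multiplicative, `v(Δ_E)` odd ⇒ `loc_v ξ_E` is RAMIFIED (inertia ↠ `⟨(1 1;0 1)⟩ ≅ ℤ/4` on
  `E[4]` through the Kummer character of the Tate period; `ξ|_{1+2M₂} = pr_V`, `ξ((1 2;0 1)) = pr_V(n₁₂) = t₂ ≠ 0`) while `δ_v(E(ℚ_v)/2)`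
  is unramified (generated by a non-square UNIT of the Tate parametrisation, resp. by `E₀`-points in the non-split case, since the
  component group has odd order `v(Δ)` resp. order `1`) ⇒ `x_v(E) = 0`: the local Kummer condition AT `v` ALONE kills the blind spot, at every
  level `2^j`, for `E` AND for every twist `E^d` with `v ∤ d`.  On the 23715 slice odd Tamagawa forces `v(Δ)` odd at every multiplicative `v`.
* ES-21b (Λ₂, census laws at `v = 2`, candidates): good ordinary ⇒ `x_2 = 0` (DES13: 0/122); multiplicative with `v₂(Δ)` odd ⇒ `x_2 = 0`
  (0/132); good supersingular ⇒ `x_2 = 1` (134/134); additive: mixed by Kodaira type (tables in MEMO-es §21.4).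
* ES-21c (consequence): on the 23715 slice the blind spot can be Selmer only on the thin family
  `𝔉 = {Δ < 0, every odd bad prime additive, 2 ∈ {supersingular, additive}}` — elsewhere McCallum's Prop. 3.1 / Cor. 3.2 hold verbatim at
  `p = 2` for `Sel_{2^j}(E)` and `Sel_{2^j}(E^d)`, and item 28029's «inf–res bit-loss allowance» is not needed.
-/

set_option autoImplicit false

noncomputable section

open scoped Classical

namespace Summit.BirchSwinnertonDyer.Rank1Residual.F1Sign2.BlindSpotLocalLawsAtTwo

open WeierstrassCurve NumberField IsDedekindDomain
open Literature.NumberTheory.EllipticCurves Literature.NumberTheory.EllipticCurves.ModularForms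
open Literature.NumberTheory.GaloisRepresentations

/-- The finite place `v_p` of `ℚ` attached to a rational prime `p` (Mathlib/tree `Rat.HeightOneSpectrum.primesEquiv`). [folklore] -/
def primePlace (p : ℕ) [hp : Fact p.Prime] : HeightOneSpectrum (𝓞 ℚ) :=
  Rat.HeightOneSpectrum.primesEquiv.symm ⟨p, hp.out⟩

/-- **The Čebotarev blind spot at level `(k, j)`**: the classes of `H¹(ℚ, E[2^j])` that die on `Γ_{ℚ(E[2^k])}` — the kernel of McCallum's
restriction map (2) (1991, §3).  For `ρ_{E,2^∞}` onto, `1 ≤ j ≤ k`, `2 ≤ k` it is `{0, ι_*ξ_E}` (MEMO-es §19 `InflationLineAtTwoPow`).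
[cite: McCallumLMS1991, §3] -/
def DiesOnDivisionField (W : WeierstrassCurve ℚ) [W.IsElliptic] (j k : ℕ) (x : galH1Torsion W ((2 ^ j : ℕ) : ℤ)) : Prop :=
  ∀ ρ ∈ torsionFixing W ((2 ^ k : ℕ) : ℤ), h1Eval W ((2 ^ j : ℕ) : ℤ) x ρ = 0

/-- **ES-21a `BlindSpotRamifiedAtOddMultiplicativeAtTwo` (Λ_odd-mult; candidate, THEOREM-grade; NEW as a statement): at an odd prime `p` of
multiplicative reduction with `v_p(Δ_E)` odd, the local Kummer condition at `p` alone kills the Čebotarev blind spot, at every level.**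
For `ρ_{E,2^∞}` onto, `1 ≤ j ≤ k`, `2 ≤ k`: a class `x ∈ H¹(ℚ, E[2^j])` lying in `δ_p(E(ℚ_p)/2^j) = ker(H¹(ℚ, E[2^j]) → H¹(ℚ_p, E))` and dying
on `Γ_{ℚ(E[2^k])}` is `0`.  Mechanism: `x ∈ {0, ι_*ξ_E}`; inertia at `p` acts on `E[4]` through `g = (1 1; 0 1)` of order `4` (Kummer character
of the Tate period `q`, `v(q) = v_p(Δ)` odd), `ξ_E(g²) = pr_V(n₁₂) ≠ 0`, so `res_{I_p} loc_p ξ_E ≠ 0`; but `δ_p(E(ℚ_p)/2) ⊂ H¹_ur` (Tate curve: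
`E(ℚ_p)/2 = ℚ_p^*/(ℚ_p^{*2} q^ℤ)` is generated by a unit; non-split: by `E₀(ℚ_p) ↠ Ẽ_ns(𝔽_p)`, component group trivial), and
`ι_*ξ_E ∈ δ_p(E(ℚ_p)/2^j) ⟺ ξ_E ∈ δ_p(E(ℚ_p)/2)` (same image in `H¹(ℚ_p, E)`).  Census ES-21/F21 (kit `es21`, P1): `x_p = 0` at every odd
multiplicative prime with `v_p(Δ)` odd — DES13 in-seat pre-test 0/505 curve-level violations (frame j296051).  Why it might fail: only a slip in
the identification of `ξ|_{1+2M₂(ℤ/4)}` with `pr_V` (brute-forced by gk2-p4, p639364/p640652: `ξ(Frob_ℓ²)≠0 ⟺ a_ℓ ≡ 2 mod 4` at `3`-cycle primes).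
Cheapest falsifier: ONE curve with onto `ρ_{E,4}`, an odd multiplicative `p`, `v_p(Δ)` odd and `x_p = 1` in the F21 table.
[cite: McCallumLMS1991, §3 Prop. 3.1] [cite: SilvermanAEC2009, C.14 (Tate curve)] [cite: LawsonWuthrich2016, §7.1] -/
def BlindSpotRamifiedAtOddMultiplicativeAtTwo : Prop :=
  ∀ (W : WeierstrassCurve ℚ) [W.IsElliptic] [W.IsGloballyMinimal], (∀ n : ℕ, W.HasSurjectiveModNGaloisRep ((2 ^ n : ℕ) : ℤ)) →
    ∀ (p : ℕ) [Fact p.Prime], p ≠ 2 → W.HasMultiplicativeReductionAtPrime p → Odd (padicValRat p W.Δ) →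
    ∀ (j k : ℕ), 1 ≤ j → j ≤ k → 2 ≤ k →
    ∀ x : galH1Torsion W ((2 ^ j : ℕ) : ℤ),
      x ∈ selmerLocalKer W ((primePlace p).adicCompletion ℚ) ((2 ^ j : ℕ) : ℤ) → DiesOnDivisionField W j k x → x = 0

/-- **Support `OddValOfOddTamagawaMultiplicative` (Tate's algorithm, Literature-grade):** on a globally minimal model, at a prime `p` of
multiplicative reduction `c_p = v_p(Δ)` (split) or `c_p = 2 - (v_p(Δ) mod 2)` (non-split); hence an odd Tamagawa PRODUCT forces `v_p(Δ)` odd at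
every multiplicative prime. [cite: SilvermanAEC2009, C.15 Table 15.1] [cite: IV1975, §1] -/
def OddValOfOddTamagawaMultiplicative : Prop :=
  ∀ (W : WeierstrassCurve ℚ) [W.IsElliptic] [W.IsGloballyMinimal], Odd W.tamagawaProduct →
    ∀ (p : ℕ) [Fact p.Prime], W.HasMultiplicativeReductionAtPrime p → Odd (padicValRat p W.Δ)

/-- **ES-21a′ `SelmerRestrictionInjectiveOfOddMultiplicativeAtTwo` (RIS_mult; candidate, THEOREM-grade given ES-21a): on the odd-Tamagawa
big-image slice, ONE odd multiplicative prime makes McCallum's restriction (2) injective on `Sel_{2^j}(E/ℚ)` at every level** — the `p = 2`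
defect of McCallum 1991 Prop. 3.1 / Cor. 3.2 and of Gross 1991 Prop. 9.1 is absent (no «bit-loss allowance», cf. GenusKolyvaginAtTwo item
`ShaCardDvdPowAtTwoR`).  Binders: the 23715 image/Tamagawa binders, `∃` an odd multiplicative prime.  Why it might fail: as ES-21a.
[cite: McCallumLMS1991, §3 Prop. 3.1, Cor. 3.2] [cite: GrossLMS1991, Prop. 9.1] -/
def SelmerRestrictionInjectiveOfOddMultiplicativeAtTwo : Prop :=
  ∀ (W : WeierstrassCurve ℚ) [W.IsElliptic] [W.IsGloballyMinimal], (∀ n : ℕ, W.HasSurjectiveModNGaloisRep ((2 ^ n : ℕ) : ℤ)) →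
    Odd W.tamagawaProduct → (∃ (p : ℕ) (_ : Fact p.Prime), p ≠ 2 ∧ W.HasMultiplicativeReductionAtPrime p) →
    ∀ (j k : ℕ), 1 ≤ j → j ≤ k → 2 ≤ k →
    ∀ x : galH1Torsion W ((2 ^ j : ℕ) : ℤ), x ∈ selmerGroup W ((2 ^ j : ℕ) : ℤ) → DiesOnDivisionField W j k x → x = 0

/-- Glue (kernel): Λ_odd-mult + Tate's `c_p`-table give RIS_mult on the odd-Tamagawa slice. -/
theorem selmerRestrictionInjective_of_blindSpotRamified (hΛ : BlindSpotRamifiedAtOddMultiplicativeAtTwo)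
    (hT : OddValOfOddTamagawaMultiplicative) : SelmerRestrictionInjectiveOfOddMultiplicativeAtTwo := by
  intro W _ _ hsurj htam hmult j k hj hjk hk x hsel hdies
  obtain ⟨p, hp, hp2, hm⟩ := hmult
  have hodd : Odd (padicValRat p W.Δ) := hT W htam p hm
  have hloc : x ∈ selmerLocalKer W ((primePlace p).adicCompletion ℚ) ((2 ^ j : ℕ) : ℤ) :=
    ((mem_selmerGroup_iff W _ x).1 hsel).1 (primePlace p)
  exact hΛ W hsurj p hp2 hm hodd j k hj hjk hk x hloc hdies

/-- **ES-21a on the crux slice (kernel corollary):** under the VERBATIM image/Tamagawa binders of `RankOneAtTwoBigImageOddLocal` (stmt-23715) plus one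
odd multiplicative prime, a `2^j`-Selmer class dying on `ℚ(E[2^k])` vanishes. -/
theorem selmer_eq_zero_of_dies_slice (hΛ : BlindSpotRamifiedAtOddMultiplicativeAtTwo) (hT : OddValOfOddTamagawaMultiplicative)
    (W : WeierstrassCurve ℚ) [W.IsElliptic] [W.IsGloballyMinimal]
    (hsurj : ∀ n : ℕ, W.HasSurjectiveModNGaloisRep ((2 ^ n : ℕ) : ℤ)) (htam : Odd W.tamagawaProduct)
    (p : ℕ) [Fact p.Prime] (hp2 : p ≠ 2) (hm : W.HasMultiplicativeReductionAtPrime p)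
    (j k : ℕ) (hj : 1 ≤ j) (hjk : j ≤ k) (hk : 2 ≤ k)
    (x : galH1Torsion W ((2 ^ j : ℕ) : ℤ)) (hx : x ∈ selmerGroup W ((2 ^ j : ℕ) : ℤ)) (hdies : DiesOnDivisionField W j k x) : x = 0 :=
  selmerRestrictionInjective_of_blindSpotRamified hΛ hT W hsurj htam ⟨p, ‹_›, hp2, hm⟩ j k hj hjk hk x hx hdies

/-- **ES-21b₁ `BlindSpotNotKummerAtTwoOrdinary` (Λ₂-ord; candidate, CONJECTURE with mechanism): at good ORDINARY reduction at `2` the blind spot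
fails the local Kummer condition at `2`.**  Mechanism (MEMO-es §21.2, `Δ ≡ 1 mod 4` case proved on paper): the étale shadow of `loc_2 ξ_E` is the
ramified character `χ_{-1}` or `χ_{-Δ}`, while `δ_2(E(ℚ_2)/2)` has unramified étale shadow.  Census F21 (P3): DES13 0/122 ordinary curves with
`x_2 = 1`.  Why it might fail: the `Δ ≡ 3 (mod 4)`-unit-part case is not covered by the paper argument (tabulated by the kit job).
LANDING NOTE (-ty g11, 2026-08-28; = ES-22b of MEMO-es §22, census now 451/451 ordinary rows by THREE engines — F21 PARI kit j312155, `engine22.py`,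
REF1 kit j315449 `nfislocalpower`): PROOF STATUS after REF1-AUDIT-v1 §132 (refuter-bsd-f1-sign2-ref1 g12, 18:54Z) — (a) `Δ ≡ 1 (mod 4)` PAPER-COMPLETE
(Lemma A's corollary `f′(θ°) ∈ ℚ₂*²` + Lemma B `sh(K₂) = {1,5}`: `sh(α) = −Δ ≡ 3 (4) ∉ {1,5}·□`); (b1) `Δ ≡ 7 (mod 8)` PAPER-COMPLETE with REF1's added
valuation line r132-1 (`v_M(θ₁) = 4 + v₂(b₆)` ⇒ `[m_α] ∈ [2]·{[1],[5]}` ⇒ `x₂ = 0`); (b2) `Δ ≡ 3 (mod 8)` (157/451 rows) NOT paper-complete — a theorem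
MODULO the census-certified K₂-coset fact «K₂ ⊃ coset B = (5,{[±2√Δ]})» (157/157 rows, 1 727/1 727 points; REF1 F132-C = REF2 ρ22-2), closure targets
r132-2 (pairing-free residue statement of the `SsResidueCheck` kind) / r132-3 (flat-cohomology rigidity: `K₂ = H¹_fl(ℤ₂, 𝓔[2])` depends only on
`Δ mod ℤ₂*²`, so ONE certified 2-descent at 2 on 53a1 settles all `Δ ≡ 3 (8)`; REF2 v39-add1 A2: KNOWN-type assembly, Česnavičius 2016 Prop 2.5 +
Tate–Oort, with the printed caution that at `e = 1 = p − 1` the finite flat model is not determined by the generic Galois module).  F132-A: MEMO-es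
Lemma A is MISSTATED as a GL₂(ℤ/4)-identity (true on `B♭ = Stab(C₄ ∋ T°)`, which contains every `ρ_{E,4}(G_{ℚ_v})` used; corollaries intact).  The
`@[conjecture]` attribute is KEPT (typer rule: no attribute removal; it flips only when a kernel proof `_holds` lands); the §22 laws that use this
decl by name live in `F1Sign2/BlindSpotLocalLawsAtTwoGood.lean` (p660125).
[cite: LawsonWuthrich2016, §7.1] [cite: SilvermanAEC2009, X.§4] -/
@[conjecture] def BlindSpotNotKummerAtTwoOrdinary : Prop :=
  ∀ (W : WeierstrassCurve ℚ) [W.IsElliptic] [W.IsGloballyMinimal], (∀ n : ℕ, W.HasSurjectiveModNGaloisRep ((2 ^ n : ℕ) : ℤ)) →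
    IsOrdinaryAt W 2 →
    ∀ (j k : ℕ), 1 ≤ j → j ≤ k → 2 ≤ k →
    ∀ x : galH1Torsion W ((2 ^ j : ℕ) : ℤ),
      x ∈ selmerLocalKer W ((primePlace 2).adicCompletion ℚ) ((2 ^ j : ℕ) : ℤ) → DiesOnDivisionField W j k x → x = 0

/-- **ES-21b₂ `BlindSpotNotKummerAtTwoMultiplicativeOddVal` (Λ₂-mult; candidate, CONJECTURE with mechanism): at multiplicative reduction at `2`
with `v₂(Δ)` odd the blind spot fails the local Kummer condition at `2`** (same Tate-curve mechanism as ES-21a, now with the extra unit/wild bit of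
`E(ℚ₂)/2`, `dim = dim E(ℚ₂)[2] + 1`).  Census F21 (P2): DES13 0/132.  Why it might fail: the extra `+1` generator of `δ_2(E(ℚ_2)/2)` could be
ramified in a direction meeting `loc_2 ξ_E` (not seen in 132 cases; `v₂(Δ)` even IS mixed: 3/6). [cite: SilvermanAEC2009, C.14] -/
@[conjecture] def BlindSpotNotKummerAtTwoMultiplicativeOddVal : Prop :=
  ∀ (W : WeierstrassCurve ℚ) [W.IsElliptic] [W.IsGloballyMinimal], (∀ n : ℕ, W.HasSurjectiveModNGaloisRep ((2 ^ n : ℕ) : ℤ)) →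
    W.HasMultiplicativeReductionAtPrime 2 → Odd (padicValRat 2 W.Δ) →
    ∀ (j k : ℕ), 1 ≤ j → j ≤ k → 2 ≤ k →
    ∀ x : galH1Torsion W ((2 ^ j : ℕ) : ℤ),
      x ∈ selmerLocalKer W ((primePlace 2).adicCompletion ℚ) ((2 ^ j : ℕ) : ℤ) → DiesOnDivisionField W j k x → x = 0

/-- **ES-21c `BlindSpotSelmerOnlyOnThinFamilyAtTwo` (RIS off `𝔉`; candidate = ES-21a ∧ ES-21b₁ ∧ ES-21b₂ assembled on the 23715 slice):** under the
verbatim binders of `RankOneAtTwoBigImageOddLocal`, if `E` has an odd multiplicative prime, OR good ordinary reduction at `2`, OR multiplicative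
reduction at `2`, then every `2^j`-Selmer class dying on `ℚ(E[2^k])` is `0` — the Čebotarev blind spot can be Selmer only on
`𝔉 = {all odd bad primes additive} ∩ {2 supersingular or additive}` (and then only at `Δ < 0`, MEMO-es §19).  Census F21 (P5): the `b(E) = 1` curves
of the slice all lie in `𝔉` (DES13 pre-test: 2/510, `190512l1 = 2⁴3⁵7²`, `363609v1 = 3⁴67²`).  Why it might fail: as ES-21b₁/b₂ (ES-21a is
theorem-grade). [cite: McCallumLMS1991, §3, §5 Thm. 5.4] [cite: GrossLMS1991, Prop. 9.1]
REF1 §127: assembled ✓ (`blindSpotSelmerOnlyOnThinFamily_of_laws`); the binders `¬ W.HasCM` and `Odd W.torsionOrder` are DECORATION (never used in the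
glue — kept verbatim as the 23715 slice binders; REF1 e1/e1′).  REF2 v35-add1 §A2: the injectivity consequence off 𝔉 is «yes-small beyond print IF
kernel-proved incl. the leaves» (ES-19a precedent), today no. -/
def BlindSpotSelmerOnlyOnThinFamilyAtTwo : Prop :=
  ∀ (W : WeierstrassCurve ℚ) [W.IsElliptic] [W.IsGloballyMinimal],
    ¬ W.HasCM → (∀ n : ℕ, W.HasSurjectiveModNGaloisRep ((2 ^ n : ℕ) : ℤ)) → Odd W.torsionOrder → Odd W.tamagawaProduct →
    ((∃ (p : ℕ) (_ : Fact p.Prime), p ≠ 2 ∧ W.HasMultiplicativeReductionAtPrime p) ∨ IsOrdinaryAt W 2 ∨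
      W.HasMultiplicativeReductionAtPrime 2) →
    ∀ (j k : ℕ), 1 ≤ j → j ≤ k → 2 ≤ k →
    ∀ x : galH1Torsion W ((2 ^ j : ℕ) : ℤ), x ∈ selmerGroup W ((2 ^ j : ℕ) : ℤ) → DiesOnDivisionField W j k x → x = 0

/-- Glue (kernel): the three local laws + Tate's table assemble to ES-21c. -/
theorem blindSpotSelmerOnlyOnThinFamily_of_laws (hΛ : BlindSpotRamifiedAtOddMultiplicativeAtTwo)
    (hT : OddValOfOddTamagawaMultiplicative) (hord : BlindSpotNotKummerAtTwoOrdinary)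
    (hm2 : BlindSpotNotKummerAtTwoMultiplicativeOddVal) : BlindSpotSelmerOnlyOnThinFamilyAtTwo := by
  intro W _ _ _ hsurj _ htam hcase j k hj hjk hk x hsel hdies
  have hloc : ∀ v : HeightOneSpectrum (𝓞 ℚ), x ∈ selmerLocalKer W (v.adicCompletion ℚ) ((2 ^ j : ℕ) : ℤ) :=
    ((mem_selmerGroup_iff W _ x).1 hsel).1
  rcases hcase with ⟨p, hp, hp2, hm⟩ | ho | hm
  · exact hΛ W hsurj p hp2 hm (hT W htam p hm) j k hj hjk hk x (hloc _) hdies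
  · exact hord W hsurj ho j k hj hjk hk x (hloc _) hdies
  · exact hm2 W hsurj hm (hT W htam 2 hm) j k hj hjk hk x (hloc _) hdies

end Summit.BirchSwinnertonDyer.Rank1Residual.F1Sign2.BlindSpotLocalLawsAtTwo

/-! ## §B. The decomposition of ES-21a into three Literature-grade leaves + one PROVED level-change lemma (BC3-style skeleton)

`BlindSpotRamifiedAtOddMultiplicativeAtTwo` ⟸ (L1) the level-`4` class is RAMIFIED at an odd multiplicative prime with `v_p(Δ)` odd (steps (i)+(ii) of MEMO-es
§21.2) + (L2) the Kummer image at such a prime is UNRAMIFIED (step (iii), Tate curve) + (L3) every non-zero class of `H¹(ℚ, E[2^j])` dying on `ℚ(E[2^k])` is the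
image of a non-zero class of `H¹(ℚ, E[2])` dying on `ℚ(E[4])` (the inflation line, MEMO-es §19 ES-19b) + (L4) level independence of the Kummer condition (PROVED).
-/

namespace Summit.BirchSwinnertonDyer.Rank1Residual.F1Sign2.BlindSpotLocalLawsAtTwo

open WeierstrassCurve NumberField IsDedekindDomain
open Literature.NumberTheory.EllipticCurves Literature.NumberTheory.EllipticCurves.ModularForms
open Literature.NumberTheory.GaloisRepresentations

/-- **L1 `LevelFourClassRamifiedAtOddMultiplicative` (leaf, THEOREM-grade; group theory + Tate-curve inertia):** for `ρ_{E,2^∞}` onto, `p` odd multiplicative with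
`v_p(Δ)` odd, a NON-ZERO class of `H¹(ℚ, E[2])` dying on `Γ_{ℚ(E[4])}` (i.e. `ξ_E`) is ramified at some prime of `ℚ̄` above `p`: inertia maps onto `⟨(1 1;0 1)⟩ ⊂ GL₂(ℤ/4)`
(Kummer character of the Tate period) and `ξ_E((1 2;0 1)) = pr_V(n₁₂) ≠ 0`.  Why it might fail: only the identification `ξ|_{1+2M₂(ℤ/4)} = pr_V`.
[cite: SilvermanAEC2009, C.14] [cite: LawsonWuthrich2016, §7.1] -/
def LevelFourClassRamifiedAtOddMultiplicative : Prop :=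
  ∀ (W : WeierstrassCurve ℚ) [W.IsElliptic] [W.IsGloballyMinimal], (∀ n : ℕ, W.HasSurjectiveModNGaloisRep ((2 ^ n : ℕ) : ℤ)) →
    ∀ (p : ℕ) [Fact p.Prime], p ≠ 2 → W.HasMultiplicativeReductionAtPrime p → Odd (padicValRat p W.Δ) →
    ∀ x : galH1Torsion W ((2 ^ 1 : ℕ) : ℤ), x ≠ 0 → DiesOnDivisionField W 1 2 x →
      ∃ 𝔓 ∈ (primePlace p).primesAbove, x ∉ unramifiedKer (geomTorsion W ((2 ^ 1 : ℕ) : ℤ)) 𝔓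

/-- **L2 `KummerUnramifiedAtOddMultiplicativeOddVal` (leaf, Literature-grade; Tate curve):** at an odd multiplicative prime `p` with `v_p(Δ)` odd the local Kummer condition
`δ_p(E(ℚ_p)/2)` consists of classes unramified at every prime above `p` (split: `E(ℚ_p)/2 = ℚ_p^*/(ℚ_p^{*2} q^ℤ)` is generated by a unit; non-split: component group
`(ℤ/v(q))^{Frob = -1} = 0`, `E₀ ↠ Ẽ_ns(𝔽_p)`, halving an `E₀`-point is unramified).  Why it might fail: it does not for `v_p(Δ)` even (F21: K-basis ramified 3/3 at
`v ≡ 2 (4)`). [cite: SilvermanAEC2009, C.14 Thm. 14.1] [cite: SilvermanAEC2009, Cor. X.4.4]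
REF1 §127: (iii) AEC C.14-standard ✓.  REF2 v35-add1 §A2-PS: KNOWN-type — the printed criterion is «image of E(K_v)/p unramified at v ∤ p ⟺
p ∤ #Φ_v(k̄_v)» and #Φ(k̄) = v_p(Δ) for multiplicative reduction of EITHER type over K_v^{ur}, so the binder «v_p(Δ) odd» is exactly right and «c_p odd»
alone would NOT be (Schaefer–Stoll 2004 §3-type statement). -/
def KummerUnramifiedAtOddMultiplicativeOddVal : Prop :=
  ∀ (W : WeierstrassCurve ℚ) [W.IsElliptic] [W.IsGloballyMinimal],
    ∀ (p : ℕ) [Fact p.Prime], p ≠ 2 → W.HasMultiplicativeReductionAtPrime p → Odd (padicValRat p W.Δ) →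
    ∀ 𝔓 ∈ (primePlace p).primesAbove,
      selmerLocalKer W ((primePlace p).adicCompletion ℚ) ((2 ^ 1 : ℕ) : ℤ) ≤ unramifiedKer (geomTorsion W ((2 ^ 1 : ℕ) : ℤ)) 𝔓

/-- **L3 `BlindSpotFromLevelFour` (leaf, THEOREM-grade; the inflation line, MEMO-es §19 ES-19b):** for `ρ_{E,2^∞}` onto, `1 ≤ j ≤ k`, `2 ≤ k`, every non-zero class of
`H¹(ℚ, E[2^j])` dying on `Γ_{ℚ(E[2^k])}` is `ι_*` of a non-zero class of `H¹(ℚ, E[2])` dying on `Γ_{ℚ(E[4])}` (`H¹(GL₂(ℤ/2^k), (ℤ/2^j)²) = ℤ/2 · ι_*ξ_E`; brute force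
`k ≤ 4`, `es19/h1levels.py`).  Why it might fail: a slip in the exact-sequence step `H¹(G, E[2]) ↠ H¹(G, E[2^j])`. [cite: LawsonWuthrich2016, §7.1] -/
def BlindSpotFromLevelFour : Prop :=
  ∀ (W : WeierstrassCurve ℚ) [W.IsElliptic], (∀ n : ℕ, W.HasSurjectiveModNGaloisRep ((2 ^ n : ℕ) : ℤ)) →
    ∀ (j k : ℕ), 1 ≤ j → j ≤ k → 2 ≤ k → ∀ (h : ((2 ^ 1 : ℕ) : ℤ) ∣ ((2 ^ j : ℕ) : ℤ)),
    ∀ x : galH1Torsion W ((2 ^ j : ℕ) : ℤ), x ≠ 0 → DiesOnDivisionField W j k x →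
      ∃ ξ : galH1Torsion W ((2 ^ 1 : ℕ) : ℤ), ξ ≠ 0 ∧ DiesOnDivisionField W 1 2 ξ ∧ x = torsionH1OfDvd W h ξ

/-- **L4 (PROVED): level independence of the Kummer condition** — `ι_* c` satisfies the `2^j`-Kummer condition at a place iff `c` satisfies the `2`-Kummer condition there
(both say the image in `H¹(ℚ_v, E)` vanishes; tree `mem_selmerLocalKer_iff_torsionH1ToH1_mem` + `torsionH1ToH1_torsionH1OfDvd`). [cite: SerreGaloisCohomology1997, I.§2.4] -/
theorem torsionH1OfDvd_mem_selmerLocalKer_iff (W : WeierstrassCurve ℚ) (E : Type) [Field E] [Algebra ℚ E] {d n : ℤ} (h : d ∣ n)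
    (c : galH1Torsion W d) : torsionH1OfDvd W h c ∈ selmerLocalKer W E n ↔ c ∈ selmerLocalKer W E d := by
  rw [mem_selmerLocalKer_iff_torsionH1ToH1_mem, mem_selmerLocalKer_iff_torsionH1ToH1_mem, torsionH1ToH1_torsionH1OfDvd]

/-- `2 ∣ 2^j` for `1 ≤ j` (the level-change divisibility used by `ι_*`). -/
theorem two_dvd_two_pow {j : ℕ} (hj : 1 ≤ j) : ((2 ^ 1 : ℕ) : ℤ) ∣ ((2 ^ j : ℕ) : ℤ) := by
  exact_mod_cast Nat.pow_dvd_pow 2 hj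

/-- **Glue (kernel): ES-21a from the three leaves L1–L3 (+ L4 proved).** -/
theorem blindSpotRamifiedAtOddMultiplicative_of (h1 : LevelFourClassRamifiedAtOddMultiplicative) (h2 : KummerUnramifiedAtOddMultiplicativeOddVal)
    (h3 : BlindSpotFromLevelFour) : BlindSpotRamifiedAtOddMultiplicativeAtTwo := by
  intro W _ _ hsurj p _ hp2 hm hodd j k hj hjk hk x hloc hdies
  by_contra hx
  obtain ⟨ξ, hξ, hξdies, rfl⟩ := h3 W hsurj j k hj hjk hk (two_dvd_two_pow hj) x hx hdies
  have hξloc : ξ ∈ selmerLocalKer W ((primePlace p).adicCompletion ℚ) ((2 ^ 1 : ℕ) : ℤ) :=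
    (torsionH1OfDvd_mem_selmerLocalKer_iff W _ _ ξ).1 hloc
  obtain ⟨𝔓, h𝔓, hram⟩ := h1 W hsurj p hp2 hm hodd ξ hξ hξdies
  exact hram (h2 W p hp2 hm hodd 𝔓 h𝔓 hξloc)

end Summit.BirchSwinnertonDyer.Rank1Residual.F1Sign2.BlindSpotLocalLawsAtTwo
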